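import Literature.Probability.LatticeModels.KCTwoPointSup
import Literature.Probability.LatticeModels.KCSectionFamilyBoundaryMesh
import HarnessLib

/-!
# The a-priori bound of the Kadanoff–Ceva primitive of the two-point family away from the marked points

Topic `Literature/Probability/LatticeModels`. Chelkak–Hongler–Izyurov 2015, proof of Thm 2.16 (§3.4,
"It remains to justify the uniform boundedness of `H_δ` away from `a, a₁, …`. … This implies that
for any `0 < ε₁ < ε` we have `M_δ(ε₁) ≤ C M_δ(ε)`") and Lemma 3.10, for the two-point family
`twoPointFamily Ω a b`, in the tree's renormalised form: with `𝓜_δ(R)` the sup of `|H - c_δ|` over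
the cells outside the lattice boxes of radius `R` around the two marked points (`KCTwoPointSup.lean`),
`R₀(δ) = ⌈ε₀/δ⌉` and the **normaliser `N_δ = S₀(δ)² + 𝓜_δ(R₀(δ))`** (`S₀` the magnetisation-type
constant at the source),

* `holeFree_compVol` — the component volume is hole-free; `eventually_deep_mem_compVol` — deep sites
  are in the component volume;
* `eventually_collar` — for all small `δ`, `Hw ≥ c - N/2` and `Hb ≤ c + N/2` on a `d`-collar of
  `∂Ω` (`KCSectionFamilyBoundaryMesh`);
* **`eventually_oneStep`** — `𝓜_δ(R) ≤ max(N_δ/2, 132 · 𝓜_δ(R + t(R)))` for `R_min ≤ R ≤ R₀(δ)`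
  (`supDev_le_max_layerDev` + `twoPointFamily_layer_sink/source`, `t(R) ≍ R`);
* **`eventually_supDev_le`** — iterating: for every `θ ∈ (0, 1]`, `𝓜_δ(⌈θ ε₀/δ⌉) ≤ C(θ) N_δ`, whence
  **`apriori_bound`**: on every compact `K ⊆ Ω ∖ {a, b}`, `|H - c_δ| ≤ C(K) N_δ` for all small `δ`;
* **`eventually_nondegenerate`** — `𝓜_δ(R₀) ≤ N_δ/2`, or `|H - c_δ| ≥ 𝓜_δ(R₀)` at some cell of the
  layer of radius `R₀(δ)` (the cell `z^max_δ` of CHI's Lemma 3.10).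

Everything is proved; no named fact.

## References

* D. Chelkak, C. Hongler, K. Izyurov, Ann. of Math. 181 (2015), §3.4 (proof of Thm 2.16) and
  Lemma 3.10 [ChelkakHonglerIzyurovAnnals2015].
-/

noncomputable section

namespace Literature.Probability.LatticeModels

open Complex Filter Metric Set _root_.Topology Finset SimpleGraph WeakBeurling
open Literature.Probability.LatticeModels.Polyomino

variable {Ω : Set ℂ} {a b : ℂ}

/-! ### The component volume is hole-free -/

/-- A different component of a hole-free set of sites avoids the distinguished component by face
steps: every site of the component of `g` is joined to `g` by steps avoiding `compVol`. [folklore] -/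
theorem reflTransGen_faceStep_of_mem_compOf {δ : ℝ} {g k : Site 2}
    (hg : g ∉ compVol Ω a δ) (hk : k ∈ compOf (↑(meshInteriorFinset Ω δ) : Set (Site 2)) g) :
    Relation.ReflTransGen (FaceStep (↑(compVol Ω a δ) : Set (Site 2))) g k := by
  set T : Set (Site 2) := ↑(meshInteriorFinset Ω δ)
  -- no site of the component of `g` is in `compVol`
  have hdisj : ∀ x ∈ compOf T g, x ∉ compVol Ω a δ := fun x hx hxc => by
    have h1 : g ∈ compOf T x := mem_compOf_symm hx
    exact hg (mem_compVol.2 (mem_compOf_trans (mem_compVol.1 hxc) h1))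
  obtain ⟨h₀, hkT, hr⟩ := hk
  -- induction along a walk in the induced graph
  rw [SimpleGraph.reachable_iff_reflTransGen] at hr
  have key : ∀ x : T, Relation.ReflTransGen ((zdGraph 2).induce T).Adj ⟨g, h₀⟩ x →
      (x : Site 2) ∈ compOf T g ∧ Relation.ReflTransGen (FaceStep (↑(compVol Ω a δ) : Set (Site 2))) g x := by
    intro x hx
    induction hx with
    | refl => exact ⟨mem_compOf_self h₀, Relation.ReflTransGen.refl⟩
    | @tail y z _ hyz ih =>
      have hadj : (zdGraph 2).Adj (y : Site 2) (z : Site 2) := SimpleGraph.comap_adj.1 hyz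
      have hz : (z : Site 2) ∈ compOf T g := mem_compOf_of_adj ih.1 z.2 hadj
      exact ⟨hz, ih.2.tail ⟨hadj, hdisj _ ih.1, hdisj _ hz⟩⟩
  exact (key ⟨k, hkT⟩ hr).2

/-- **The component volume of a hole-free set of free sites is hole-free.** [folklore] -/
theorem holeFree_compVol {δ : ℝ} (hHF : HoleFree (↑(meshInteriorFinset Ω δ) : Set (Site 2))) :
    HoleFree (↑(compVol Ω a δ) : Set (Site 2)) := by
  classical
  set T : Set (Site 2) := ↑(meshInteriorFinset Ω δ) with hT
  have hsub : (↑(compVol Ω a δ) : Set (Site 2)) ⊆ T := fun x hx => Finset.mem_coe.2 (compVol_subset (Finset.mem_coe.1 hx))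
  intro g hg M
  by_cases hgT : g ∈ T
  · -- `g` is free but in another component `U`; climb to the top of `U` and leave `T`
    set U := compOf T g with hU
    have hUfin : U.Finite := (meshInteriorFinset Ω δ).finite_toSet.subset (compOf_subset T g)
    have hUne : hUfin.toFinset.Nonempty := ⟨g, hUfin.mem_toFinset.2 (mem_compOf_self hgT)⟩
    obtain ⟨u, hu, humax⟩ := hUfin.toFinset.exists_max_image (fun u : Site 2 => u 1) hUne
    have huU : u ∈ U := hUfin.mem_toFinset.1 hu
    have hup : u + cornerUnit 1 ∉ T := fun hupT => by
      have : u + cornerUnit 1 ∈ U := mem_compOf_of_adj huU hupT (zdGraph_adj_add_cornerUnit u 1)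
      have := humax _ (hUfin.mem_toFinset.2 this)
      simp [cornerUnit] at this
    -- escape from `u + e₁` in the hole-free `T`
    obtain ⟨g', hg'M, hchain⟩ := hHF (u + cornerUnit 1) hup M
    refine ⟨g', hg'M, ?_⟩
    have h1 : Relation.ReflTransGen (FaceStep (↑(compVol Ω a δ) : Set (Site 2))) g u :=
      reflTransGen_faceStep_of_mem_compOf hg huU
    have huc : u ∉ compVol Ω a δ := fun huc => by
      have hg' : g ∈ compOf T u := mem_compOf_symm huU
      exact hg (mem_compVol.2 (mem_compOf_trans (mem_compVol.1 huc) hg'))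
    have h2 : FaceStep (↑(compVol Ω a δ) : Set (Site 2)) u (u + cornerUnit 1) :=
      ⟨zdGraph_adj_add_cornerUnit u 1, huc, fun h => hup (hsub h)⟩
    exact (h1.tail h2).trans (Relation.ReflTransGen.mono (fun x y hxy => FaceStep.mono hsub hxy) _ _ hchain)
  · obtain ⟨g', hg'M, hchain⟩ := hHF g hgT M
    exact ⟨g', hg'M, Relation.ReflTransGen.mono (fun x y hxy => FaceStep.mono hsub hxy) _ _ hchain⟩

/-! ### Deep sites are in the component volume -/

/-- **Eventually every site at distance `≥ d/2` from `Ωᶜ` is in the component volume** (for bounded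
`Ω`). [cite: ChelkakHonglerIzyurovAnnals2015, §3.3] -/
theorem eventually_deep_mem_compVol (hΩo : IsOpen Ω) (hΩc : IsConnected Ω) (hΩb : Bornology.IsBounded Ω)
    (hM : MeshApproximates Ω) (ha : a ∈ Ω) {d : ℝ} (hd : 0 < d) :
    ∀ᶠ δ in 𝓝[>] (0 : ℝ), ∀ w : Site 2, d / 2 ≤ infDist (meshPoint δ w) Ωᶜ → w ∈ compVol Ω a δ := by
  set K : Set ℂ := {z | d / 2 ≤ infDist z Ωᶜ} with hK
  have hKΩ : K ⊆ Ω := fun z hz => by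
    by_contra hzΩ
    have : infDist z Ωᶜ = 0 := infDist_zero_of_mem hzΩ
    have hz' : d / 2 ≤ infDist z Ωᶜ := hz
    linarith
  have hKc : IsCompact K := by
    refine Metric.isCompact_of_isClosed_isBounded ?_ (hΩb.subset hKΩ)
    exact isClosed_le continuous_const (continuous_infDist_pt Ωᶜ)
  obtain ⟨ρ, hρ, h⟩ := eventually_bulk_mem_compOf hΩo hΩc hM ha hKc hKΩ
  filter_upwards [h] with δ h w hw
  exact mem_compVol.2 (h w w hw (by rw [_root_.dist_self]; exact hρ.le)).2

/-! ### The normaliser -/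

variable (Ω a b)

/-- **The magnetisation-type constant `S₀(δ) = S_{{b̂}}(v₀, ∅) = 𝔼⁺[σ_{v₀} σ_{b̂}]`** of the two-point
family at the source site `v₀ = p₀ + e₀ + e₁`. [cite: ChelkakHonglerIzyurovAnnals2015, Def. 2.1 (normalisation E[σ_a σ_b])] -/
def srcMag0 (δ : ℝ) : ℝ :=
  kcS (discreteDomainGraph Ω δ) (compVol Ω a δ) criticalBetaTwo (.fixed 1) {nearestSite δ b} ∅
    (sourcePlaq δ a + cornerUnit 0 + cornerUnit 1)

/-- The reference lattice radius `R₀(δ) = ⌈ε₀/δ⌉`. [folklore] -/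
def refRadius (ε₀ δ : ℝ) : ℕ := ⌈ε₀ / δ⌉₊

/-- **The normaliser `N_δ = S₀(δ)² + 𝓜_δ(R₀(δ))`.** [cite: ChelkakHonglerIzyurovAnnals2015, §3.4 (renormalisation by M_δ(ε))] -/
def twoPointNorm (ε₀ δ : ℝ) : ℝ := srcMag0 Ω a b δ ^ 2 + supDev Ω a b δ (refRadius ε₀ δ)

variable {Ω a b}

/-- `N_δ ≥ 𝓜_δ(R₀) ≥ 0`. [folklore] -/
theorem supDev_le_twoPointNorm (ε₀ δ : ℝ) : supDev Ω a b δ (refRadius ε₀ δ) ≤ twoPointNorm Ω a b ε₀ δ := by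
  rw [twoPointNorm]; nlinarith [sq_nonneg (srcMag0 Ω a b δ)]

/-- `N_δ ≥ 0`. [folklore] -/
theorem twoPointNorm_nonneg (ε₀ δ : ℝ) : 0 ≤ twoPointNorm Ω a b ε₀ δ :=
  (supDev_nonneg _).trans (supDev_le_twoPointNorm ε₀ δ)

/-- **`𝓜_δ` is antitone in the radius**: larger boxes removed, smaller region. [folklore] -/
theorem supDev_antitone {δ : ℝ} {R R' : ℕ} (h : R ≤ R') : supDev Ω a b δ R' ≤ supDev Ω a b δ R := by
  refine supDev_le (supDev_nonneg R) (fun v hv => abs_hw_le_supDev ?_) (fun f hf => abs_hb_le_supDev ?_)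
  · obtain ⟨h1, h2, h3⟩ := mem_regionW.1 hv
    exact mem_regionW.2 ⟨h1, fun h' => h2 (sqBox_mono _ (by exact_mod_cast h) h'), fun h' => h3 (sqBox_mono _ (by exact_mod_cast h) h')⟩
  · obtain ⟨h1, h2, h3⟩ := mem_regionB.1 hf
    exact mem_regionB.2 ⟨h1, fun h' => h2 (sqBox_mono _ (by exact_mod_cast h) h'), fun h' => h3 (sqBox_mono _ (by exact_mod_cast h) h')⟩

/-! ### The inputs of the boundary smallness for the two-point family -/

section Inputs

variable (hΩo : IsOpen Ω) (hΩc : IsConnected Ω) (hΩb : Bornology.IsBounded Ω) (hM : MeshApproximates Ω)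
  (ha : a ∈ Ω) (hHF : ∀ᶠ δ in 𝓝[>] (0 : ℝ), HoleFree (↑(meshInteriorFinset Ω δ) : Set (Site 2))) (b : ℂ)

include hΩo hM ha hHF in
/-- The cut system of the family is admissible, eventually. [cite: ChelkakHonglerIzyurovAnnals2015, §3.3] -/
theorem eventually_cuts : ∀ᶠ δ in 𝓝[>] (0 : ℝ), IsKCCuts (discreteDomainGraph Ω δ) ((twoPointFamily Ω a b).Λ δ)
    ((twoPointFamily Ω a b).cut δ) ↑(fillFinset (touchPlaquettes ((twoPointFamily Ω a b).Λ δ))) := by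
  filter_upwards [eventually_goodScale hΩo hM ha hHF] with δ hg
  exact (twoPointData_spec b hg).1

include hΩo hM ha hHF in
/-- The primitive relation of the family, eventually. [cite: ChelkakHonglerIzyurovAnnals2015, Prop. 3.6] -/
theorem eventually_prim : ∀ᶠ δ in 𝓝[>] (0 : ℝ), IsKCPrimitive (discreteDomainGraph Ω δ) ((twoPointFamily Ω a b).Λ δ)
    criticalBetaTwo (.fixed 1) ((twoPointFamily Ω a b).B δ) ((twoPointFamily Ω a b).cut δ) ((twoPointFamily Ω a b).Hw δ)
    ((twoPointFamily Ω a b).Hb δ) ↑(fillFinset (touchPlaquettes ((twoPointFamily Ω a b).Λ δ))) := by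
  filter_upwards [eventually_goodScale hΩo hM ha hHF] with δ hg
  exact (twoPointData_spec b hg).2.2.2.1

include hΩo hM ha hHF in
/-- Odd cuts off the source plaquette, eventually. [cite: ChelkakHonglerIzyurovAnnals2015, Prop. 3.6] -/
theorem eventually_odd : ∀ᶠ δ in 𝓝[>] (0 : ℝ), ∀ p ∈ touchPlaquettes ((twoPointFamily Ω a b).Λ δ), p ≠ sourcePlaq δ a →
    Odd #(Finset.univ.filter fun j : Fin 4 => plaqSide p j ∈ (twoPointFamily Ω a b).cut δ p) := by
  filter_upwards [eventually_goodScale hΩo hM ha hHF] with δ hg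
  exact (twoPointData_spec b hg).2.2.1

include hΩo hM ha hHF in
/-- The Dirichlet normalisation by the frozen value, eventually. [cite: ChelkakHonglerIzyurovAnnals2015, Prop. 3.6] -/
theorem eventually_cst : ∀ᶠ δ in 𝓝[>] (0 : ℝ), ∀ (v : Site 2) (k : Fin 4), v ∉ (twoPointFamily Ω a b).Λ δ →
    faceAt v k ∈ fillFinset (touchPlaquettes ((twoPointFamily Ω a b).Λ δ)) → (twoPointFamily Ω a b).Hw δ v = frozenVal Ω a b δ := by
  filter_upwards [eventually_goodScale hΩo hM ha hHF] with δ hg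
  exact fun v k hv hk => hw_eq_frozenVal hg hv hk

include hHF in
/-- The volumes are hole-free, eventually. [folklore] -/
theorem eventually_holeFree : ∀ᶠ δ in 𝓝[>] (0 : ℝ), HoleFree (↑((twoPointFamily Ω a b).Λ δ) : Set (Site 2)) :=
  hHF.mono fun _ h => holeFree_compVol h

end Inputs

/-- `R₀(δ) δ < ε₀ + δ` and `ε₀ ≤ R₀(δ) δ`. [folklore] -/
theorem refRadius_mul_bounds {ε₀ δ : ℝ} (hε₀ : 0 ≤ ε₀) (hδ : 0 < δ) :
    ε₀ ≤ (refRadius ε₀ δ : ℝ) * δ ∧ (refRadius ε₀ δ : ℝ) * δ < ε₀ + δ := by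
  have h1 : ε₀ / δ ≤ (refRadius ε₀ δ : ℝ) := Nat.le_ceil _
  have h2 : (refRadius ε₀ δ : ℝ) < ε₀ / δ + 1 := Nat.ceil_lt_add_one (by positivity)
  constructor
  · have := mul_le_mul_of_nonneg_right h1 hδ.le
    rwa [div_mul_cancel₀ _ hδ.ne'] at this
  · have := mul_lt_mul_of_pos_right h2 hδ
    rwa [add_mul, div_mul_cancel₀ _ hδ.ne', one_mul] at this

/-- A cell near `∂Ω` is outside the box of radius `R₀(δ)` around a point deep inside. [folklore] -/
theorem not_mem_sqBox_of_collar {δ ε₀ : ℝ} (hδ : 0 < δ) (hε₀ : 0 < ε₀) (hδε : 2 * δ ≤ ε₀) {q : Site 2} {z : ℂ}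
    (hq : dist (meshPoint δ q) z ≤ 3 * δ) (hz : 8 * ε₀ ≤ infDist z Ωᶜ) {y : Site 2}
    (hy : infDist (meshPoint δ y) Ωᶜ ≤ ε₀) : y ∉ sqBox q (refRadius ε₀ δ) := by
  intro hyq
  have h1 := dist_meshPoint_le_two_mul_of_mem_sqBox hδ.le hyq
  have h2 := (refRadius_mul_bounds hε₀.le hδ).2
  have h1' : dist (meshPoint δ y) (meshPoint δ q) ≤ 2 * (ε₀ + δ) := by
    push_cast at h1; nlinarith
  have h3 : dist (meshPoint δ y) z ≤ 2 * (ε₀ + δ) + 3 * δ := by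
    have := dist_triangle (meshPoint δ y) (meshPoint δ q) z
    linarith
  have h4 := Metric.infDist_le_infDist_add_dist (s := Ωᶜ) (x := z) (y := meshPoint δ y)
  rw [_root_.dist_comm] at h4
  linarith

/-- **The collar bounds for the two-point family** (CHI (3.20) on the mesh, through
`KCSectionFamilyBoundaryMesh`): for all small `δ`, `Hw ≥ c_δ - N_δ/2` at the free sites and
`Hb ≤ c_δ + N_δ/2` at the touching plaquettes within `d` of `Ωᶜ`. [cite: ChelkakHonglerIzyurovAnnals2015, §3.4 (3.20)] -/
theorem eventually_collar (hΩo : IsOpen Ω) (hΩb : Bornology.IsBounded Ω) (hM : MeshApproximates Ω)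
    (ha : a ∈ Ω) (hHF : ∀ᶠ δ in 𝓝[>] (0 : ℝ), HoleFree (↑(meshInteriorFinset Ω δ) : Set (Site 2)))
    (hS : ∀ᶠ δ in 𝓝[>] (0 : ℝ), srcMag0 Ω a b δ ≠ 0)
    {ε₀ : ℝ} (hε₀ : 0 < ε₀) (hε₀a : 8 * ε₀ ≤ infDist a Ωᶜ) (hε₀b : 8 * ε₀ ≤ infDist b Ωᶜ) :
    ∃ d > 0, ∀ᶠ δ in 𝓝[>] (0 : ℝ),
      (∀ v ∈ compVol Ω a δ, infDist (meshPoint δ v) Ωᶜ ≤ d →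
        frozenVal Ω a b δ - twoPointNorm Ω a b ε₀ δ / 2 ≤ (twoPointFamily Ω a b).Hw δ v) ∧
      (∀ f ∈ touchPlaquettes (compVol Ω a δ), infDist (meshPoint δ f) Ωᶜ ≤ d →
        (twoPointFamily Ω a b).Hb δ f ≤ frozenVal Ω a b δ + twoPointNorm Ω a b ε₀ δ / 2) := by
  have hΩuniv : Ω ≠ univ := fun h => by
    have := hΩb; rw [h] at this; exact NormedSpace.unbounded_univ ℝ ℂ this
  have hΩc' : Ωᶜ.Nonempty := Set.nonempty_compl.2 hΩuniv
  set 𝓕 := twoPointFamily Ω a b with h𝓕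
  have hadj : ∀ᶠ δ in 𝓝[>] (0 : ℝ), ∀ v ∈ 𝓕.Λ δ, ∀ k : Fin 4, (discreteDomainGraph Ω δ).Adj v (v + cornerUnit k) :=
    Eventually.of_forall fun _ v hv k => compVol_adj hv k
  have hΛsub : ∀ᶠ δ in 𝓝[>] (0 : ℝ), 𝓕.Λ δ ⊆ meshInteriorFinset Ω δ := Eventually.of_forall fun _ => compVol_subset
  -- the marked cells are `2ε₀`-deep
  have hδε : ∀ᶠ δ in 𝓝[>] (0 : ℝ), 2 * δ ≤ ε₀ := by
    have : ∀ᶠ δ in 𝓝[>] (0 : ℝ), δ ≤ ε₀ / 2 := mem_nhdsWithin_of_mem_nhds (Iic_mem_nhds (by positivity))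
    exact this.mono fun δ h => by linarith
  have hfar : ∀ᶠ δ in 𝓝[>] (0 : ℝ), (∀ b' ∈ 𝓕.B δ, 2 * ε₀ ≤ infDist (meshPoint δ b') Ωᶜ) ∧
      2 * ε₀ ≤ infDist (meshPoint δ (sourcePlaq δ a)) Ωᶜ := by
    filter_upwards [hδε, self_mem_nhdsWithin] with δ hδε hδ0
    have hδ0 : (0 : ℝ) < δ := hδ0
    constructor
    · intro b' hb'
      rw [show 𝓕.B δ = {nearestSite δ b} from rfl, Finset.mem_singleton] at hb'
      subst hb'
      have h1 := dist_meshPoint_nearestSite_le hδ0 b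
      have h2 := Metric.infDist_le_infDist_add_dist (s := Ωᶜ) (x := b) (y := meshPoint δ (nearestSite δ b))
      rw [_root_.dist_comm] at h2
      linarith
    · have h1 : dist (meshPoint δ (sourcePlaq δ a)) a ≤ 3 * δ :=
        (dist_triangle _ (meshPoint δ (nearestSite δ a)) _).trans (by
          linarith [dist_meshPoint_sourcePlaq_le hδ0.le a, dist_meshPoint_nearestSite_le hδ0 a])
      have h2 := Metric.infDist_le_infDist_add_dist (s := Ωᶜ) (x := a) (y := meshPoint δ (sourcePlaq δ a))
      rw [_root_.dist_comm] at h2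
      linarith
  have hN : ∀ᶠ δ in 𝓝[>] (0 : ℝ), 0 < twoPointNorm Ω a b ε₀ δ := by
    filter_upwards [hS] with δ hS
    have := supDev_nonneg (Ω := Ω) (a := a) (b := b) (δ := δ) (refRadius ε₀ δ)
    have h2 : 0 < srcMag0 Ω a b δ ^ 2 := by positivity
    rw [twoPointNorm]; linarith
  have hapriori : ∀ᶠ δ in 𝓝[>] (0 : ℝ), ∀ y : Site 2, infDist (meshPoint δ y) Ωᶜ ≤ ε₀ →
      (y ∈ 𝓕.Λ δ → |𝓕.Hw δ y - frozenVal Ω a b δ| ≤ 1 * twoPointNorm Ω a b ε₀ δ) ∧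
      (y ∈ touchPlaquettes (𝓕.Λ δ) → |𝓕.Hb δ y - frozenVal Ω a b δ| ≤ 1 * twoPointNorm Ω a b ε₀ δ) := by
    filter_upwards [hδε, self_mem_nhdsWithin] with δ hδε hδ0 y hy
    have hδ0 : (0 : ℝ) < δ := hδ0
    have hpa : dist (meshPoint δ (sourcePlaq δ a)) a ≤ 3 * δ :=
      (dist_triangle _ (meshPoint δ (nearestSite δ a)) _).trans (by
        linarith [dist_meshPoint_sourcePlaq_le hδ0.le a, dist_meshPoint_nearestSite_le hδ0 a])
    have hpb : dist (meshPoint δ (nearestSite δ b)) b ≤ 3 * δ := by linarith [dist_meshPoint_nearestSite_le hδ0 b]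
    have hya := not_mem_sqBox_of_collar (Ω := Ω) hδ0 hε₀ hδε hpa hε₀a hy
    have hyb := not_mem_sqBox_of_collar (Ω := Ω) hδ0 hε₀ hδε hpb hε₀b hy
    rw [one_mul]
    exact ⟨fun hyΛ => (abs_hw_le_supDev (mem_regionW.2 ⟨hyΛ, hya, hyb⟩)).trans (supDev_le_twoPointNorm ε₀ δ),
      fun hyt => (abs_hb_le_supDev (mem_regionB.2 ⟨hyt, hya, hyb⟩)).trans (supDev_le_twoPointNorm ε₀ δ)⟩
  obtain ⟨d₁, hd₁, h₁⟩ := 𝓕.boundary_smallness_mesh hΩc' hΩo hΩb ⟨a, ha⟩ hM hadj (eventually_cuts hΩo hM ha hHF b)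
    (eventually_prim hΩo hM ha hHF b) (eventually_holeFree hHF b) (eventually_odd hΩo hM ha hHF b)
    (eventually_cst hΩo hM ha hHF b) hΛsub hε₀ hfar one_pos hN hapriori (1 / 2) (by norm_num)
  obtain ⟨d₂, hd₂, h₂⟩ := 𝓕.boundary_smallness_hb_mesh hΩc' hΩo hΩb ⟨a, ha⟩ hM hadj (eventually_cuts hΩo hM ha hHF b)
    (eventually_prim hΩo hM ha hHF b) (eventually_holeFree hHF b) (eventually_odd hΩo hM ha hHF b)
    (eventually_cst hΩo hM ha hHF b) hΛsub hε₀ hfar one_pos hN hapriori (1 / 2) (by norm_num)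
  refine ⟨min d₁ d₂, by positivity, ?_⟩
  filter_upwards [h₁, h₂] with δ h₁ h₂
  refine ⟨fun v hv hvd => ?_, fun f hf hfd => ?_⟩
  · have := h₁ v hv (hvd.trans (min_le_left _ _))
    rw [abs_le] at this; linarith
  · have := h₂ f hf (hfd.trans (min_le_right _ _)); linarith

/-! ### The layer max from layer bounds -/

/-- `layerDev R ≤ M` from bounds at the cells of the two layers. [folklore] -/
theorem layerDev_le {δ : ℝ} {R : ℕ} {M : ℝ} (hM : 0 ≤ M)
    (hW : ∀ v ∈ compVol Ω a δ, InLayer a b δ v R → |(twoPointFamily Ω a b).Hw δ v - frozenVal Ω a b δ| ≤ M)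
    (hB : ∀ f ∈ touchPlaquettes (compVol Ω a δ), InLayer a b δ f R → |(twoPointFamily Ω a b).Hb δ f - frozenVal Ω a b δ| ≤ M) :
    layerDev Ω a b δ R ≤ M := by
  rw [layerDev, NNReal.coe_max]
  exact max_le (coe_sup_toNNReal_le _ hM fun v hv => hW v (mem_layerW.1 hv).1 (mem_layerW.1 hv).2)
    (coe_sup_toNNReal_le _ hM fun f hf => hB f (mem_layerB.1 hf).1 (mem_layerB.1 hf).2)

/-! ### The Beurling smallness parameter -/

/-- **The absolute ratio `κ₁ = (1/(2 C_B))^{1/β}`** below which the weak Beurling factor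
`C_B x^β` is at most `1/2`. [folklore] -/
def beurlingKappa : ℝ := (1 / (2 * beurlingConst)) ^ (1 / beurlingExp)

/-- `κ₁ > 0`. [folklore] -/
theorem beurlingKappa_pos : 0 < beurlingKappa := by
  unfold beurlingKappa
  have := one_le_beurlingConst
  positivity

/-- `C_B x^β ≤ 1/2` for `0 ≤ x ≤ κ₁`. [folklore] -/
theorem beurling_small_of_le {x : ℝ} (hx0 : 0 ≤ x) (hx : x ≤ beurlingKappa) :
    beurlingConst * x ^ beurlingExp ≤ 1 / 2 := by
  have hC := one_le_beurlingConst
  have hβ := beurlingExp_pos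
  have h1 : x ^ beurlingExp ≤ beurlingKappa ^ beurlingExp := Real.rpow_le_rpow hx0 hx hβ.le
  have h2 : beurlingKappa ^ beurlingExp = 1 / (2 * beurlingConst) := by
    rw [beurlingKappa, one_div beurlingExp, Real.rpow_inv_rpow (by positivity) hβ.ne']
  rw [h2] at h1
  calc beurlingConst * x ^ beurlingExp ≤ beurlingConst * (1 / (2 * beurlingConst)) :=
        mul_le_mul_of_nonneg_left h1 (by linarith)
    _ = 1 / 2 := by field_simp

/-- **The annulus width `t(R) = ⌊κ₁ (R - 1)⌋ - 6`.** [folklore] -/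
def stepWidth (R : ℕ) : ℕ := ⌊beurlingKappa * ((R : ℝ) - 1)⌋₊ - 6

/-- **The minimal radius** `R_min = ⌈2 + 14/κ₁⌉ + 3`. [folklore] -/
def minRadius : ℕ := ⌈2 + 14 / beurlingKappa⌉₊ + 3

/-- Arithmetic of the annulus width: for `R ≥ R_min`, `t(R) + 6 ≤ κ₁ (R - 1)` and
`R (1 + κ₁/2) ≤ R + t(R)`, `3 ≤ R`. [folklore] -/
theorem stepWidth_bounds {R : ℕ} (hR : minRadius ≤ R) :
    3 ≤ R ∧ ((stepWidth R : ℝ) + 6 ≤ beurlingKappa * ((R : ℝ) - 1)) ∧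
      (R : ℝ) * (1 + beurlingKappa / 2) ≤ (R : ℝ) + stepWidth R := by
  have hκ := beurlingKappa_pos
  have hR' : (minRadius : ℝ) ≤ R := by exact_mod_cast hR
  have hceil : 2 + 14 / beurlingKappa ≤ (⌈2 + 14 / beurlingKappa⌉₊ : ℝ) := Nat.le_ceil _
  have hmin : (minRadius : ℝ) = (⌈2 + 14 / beurlingKappa⌉₊ : ℝ) + 3 := by simp [minRadius]
  have hR3 : 3 ≤ R := le_trans (by simp [minRadius]) hR
  have hRge : 2 + 14 / beurlingKappa + 3 ≤ (R : ℝ) := by linarith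
  have h14 : 14 ≤ beurlingKappa * ((R : ℝ) - 1) - beurlingKappa * 4 := by
    have : 14 / beurlingKappa ≤ (R : ℝ) - 5 := by linarith
    have := (div_le_iff₀ hκ).1 this
    nlinarith
  -- the floor
  set F : ℕ := ⌊beurlingKappa * ((R : ℝ) - 1)⌋₊ with hF
  have hx0 : 0 ≤ beurlingKappa * ((R : ℝ) - 1) := by nlinarith
  have hFle : (F : ℝ) ≤ beurlingKappa * ((R : ℝ) - 1) := Nat.floor_le hx0
  have hFlt : beurlingKappa * ((R : ℝ) - 1) < (F : ℝ) + 1 := Nat.lt_floor_add_one _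
  have hF6 : 6 ≤ F := by
    have : (6 : ℝ) ≤ F := by nlinarith
    exact_mod_cast this
  have ht : ((stepWidth R : ℕ) : ℝ) = (F : ℝ) - 6 := by
    rw [stepWidth, ← hF, Nat.cast_sub hF6]; norm_num
  refine ⟨hR3, ?_, ?_⟩
  · rw [ht]; linarith
  · rw [ht]; nlinarith

/-! ### The one-step inequality -/

/-- **One step of CHI's "`M_δ(ε₁) ≤ C M_δ(ε)`"** at a fixed mesh, from clean lattice hypotheses: the
localisation `supDev_le_max_layerDev` and the two layer bounds give
`𝓜(R) ≤ max(N/2, 132 𝓜(R + t))`. [cite: ChelkakHonglerIzyurovAnnals2015, Lemma 3.10 and §3.4] -/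
theorem oneStep_core {δ : ℝ} (hδ : 0 < δ) (hgood : GoodScale Ω a δ) {R t R₂ : ℕ} (htR : R + t ≤ R₂) {N d : ℝ} (hN : 0 ≤ N)
    (hδd : 8 * δ ≤ d)
    (hdeep : ∀ w : Site 2, d / 2 ≤ infDist (meshPoint δ w) Ωᶜ → w ∈ compVol Ω a δ)
    (hcolW : ∀ v ∈ compVol Ω a δ, infDist (meshPoint δ v) Ωᶜ ≤ d → frozenVal Ω a b δ - N / 2 ≤ (twoPointFamily Ω a b).Hw δ v)
    (hcolB : ∀ f ∈ touchPlaquettes (compVol Ω a δ), infDist (meshPoint δ f) Ωᶜ ≤ d →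
      (twoPointFamily Ω a b).Hb δ f ≤ frozenVal Ω a b δ + N / 2)
    (hboxb : ∀ y ∈ sqBox (nearestSite δ b) R₂, y ∈ compVol Ω a δ)
    (hboxa : ∀ y ∈ sqBox (sourcePlaq δ a) R₂, y ∈ compVol Ω a δ)
    (hsep : ∀ y ∈ sqBox (nearestSite δ b) R₂, y ∉ sqBox (sourcePlaq δ a) R₂)
    (hsink : ∀ c₀ m : ℝ, 0 ≤ m →
      (∀ y ∈ sqBox (nearestSite δ b) R₂, y ∉ sqBox (nearestSite δ b) ((R : ℤ) + t) →
        |(twoPointFamily Ω a b).Hw δ y - c₀| ≤ m ∧ |(twoPointFamily Ω a b).Hb δ y - c₀| ≤ m) →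
      ∀ u₀ ∈ sqBox (nearestSite δ b) R, u₀ ∉ sqBox (nearestSite δ b) ((R : ℤ) - 1) →
        -(132 * m) ≤ (twoPointFamily Ω a b).Hw δ u₀ - c₀ ∧ (twoPointFamily Ω a b).Hw δ u₀ - c₀ ≤ m ∧
        -(132 * m) ≤ (twoPointFamily Ω a b).Hb δ u₀ - c₀ ∧ (twoPointFamily Ω a b).Hb δ u₀ - c₀ ≤ m)
    (hsource : ∀ c₀ m : ℝ, 0 ≤ m →
      (∀ y ∈ sqBox (sourcePlaq δ a) R₂, y ∉ sqBox (sourcePlaq δ a) ((R : ℤ) + t) →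
        |(twoPointFamily Ω a b).Hw δ y - c₀| ≤ m ∧ |(twoPointFamily Ω a b).Hb δ y - c₀| ≤ m) →
      ∀ f₀ ∈ sqBox (sourcePlaq δ a) R, f₀ ∉ sqBox (sourcePlaq δ a) ((R : ℤ) - 1) →
        -m ≤ (twoPointFamily Ω a b).Hw δ f₀ - c₀ ∧ (twoPointFamily Ω a b).Hw δ f₀ - c₀ ≤ 132 * m ∧
        -m ≤ (twoPointFamily Ω a b).Hb δ f₀ - c₀ ∧ (twoPointFamily Ω a b).Hb δ f₀ - c₀ ≤ 132 * m) :
    supDev Ω a b δ R ≤ max (N / 2) (132 * supDev Ω a b δ (R + t)) := by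
  set c := frozenVal Ω a b δ
  set m := supDev Ω a b δ (R + t) with hm
  have hm0 : 0 ≤ m := supDev_nonneg _
  have hRt : ((R : ℤ) + t) = ((R + t : ℕ) : ℤ) := by push_cast; ring
  -- the annulus bounds
  have hannb : ∀ y ∈ sqBox (nearestSite δ b) R₂, y ∉ sqBox (nearestSite δ b) ((R : ℤ) + t) →
      |(twoPointFamily Ω a b).Hw δ y - c| ≤ m ∧ |(twoPointFamily Ω a b).Hb δ y - c| ≤ m := by
    intro y hy hy'
    rw [hRt] at hy'
    have hyΛ := hboxb y hy
    have hya : y ∉ sqBox (sourcePlaq δ a) ((R + t : ℕ) : ℤ) := fun h => hsep y hy (sqBox_mono _ (by exact_mod_cast htR) h)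
    have hyt : y ∈ touchPlaquettes (compVol Ω a δ) := by simpa [faceAt_zero_eq] using faceAt_mem_touchPlaquettes hyΛ 0
    exact ⟨abs_hw_le_supDev (mem_regionW.2 ⟨hyΛ, hya, hy'⟩), abs_hb_le_supDev (mem_regionB.2 ⟨hyt, hya, hy'⟩)⟩
  have hanna : ∀ y ∈ sqBox (sourcePlaq δ a) R₂, y ∉ sqBox (sourcePlaq δ a) ((R : ℤ) + t) →
      |(twoPointFamily Ω a b).Hw δ y - c| ≤ m ∧ |(twoPointFamily Ω a b).Hb δ y - c| ≤ m := by
    intro y hy hy'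
    rw [hRt] at hy'
    have hyΛ := hboxa y hy
    have hyb : y ∉ sqBox (nearestSite δ b) ((R + t : ℕ) : ℤ) := fun h =>
      hsep y (sqBox_mono _ (by exact_mod_cast htR) h) hy
    have hyt : y ∈ touchPlaquettes (compVol Ω a δ) := by simpa [faceAt_zero_eq] using faceAt_mem_touchPlaquettes hyΛ 0
    exact ⟨abs_hw_le_supDev (mem_regionW.2 ⟨hyΛ, hy', hyb⟩), abs_hb_le_supDev (mem_regionB.2 ⟨hyt, hy', hyb⟩)⟩
  have h132 : m ≤ 132 * m := by nlinarith
  -- the layers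
  have hcell : ∀ y : Site 2, InLayer a b δ y R →
      |(twoPointFamily Ω a b).Hw δ y - c| ≤ 132 * m ∧ |(twoPointFamily Ω a b).Hb δ y - c| ≤ 132 * m := by
    intro y hy
    rcases hy with ⟨hy1, hy2⟩ | ⟨hy1, hy2⟩
    · obtain ⟨h1, h2, h3, h4⟩ := hsource c m hm0 hanna y hy1 hy2
      rw [abs_le, abs_le]; exact ⟨⟨by linarith, h2⟩, by linarith, h4⟩
    · obtain ⟨h1, h2, h3, h4⟩ := hsink c m hm0 hannb y hy1 hy2
      rw [abs_le, abs_le]; exact ⟨⟨h1, by linarith⟩, h3, by linarith⟩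
  have hL : layerDev Ω a b δ R ≤ 132 * m :=
    layerDev_le (by positivity) (fun v _ hv => (hcell v hv).1) (fun f _ hf => (hcell f hf).2)
  have key := supDev_le_max_layerDev (Ω := Ω) (a := a) (b := b) hδ hgood R (by positivity : 0 ≤ N / 2) hδd hdeep hcolW hcolB
  exact key.trans (max_le_max le_rfl hL)

/-! ### The iteration -/

/-- **The iteration of the one-step inequality** (CHI: "`M_δ(ε₁) ≤ C M_δ(ε)` with some constant
`C` independent of `δ`"): from `f R ≤ max(A, C f(R + t(R)))` for `R_min ≤ R < R₀`, the growth
`q R ≤ R + t(R)` (`q > 1`) and antitonicity of `f`, `f R ≤ Cⁿ max(A, f R₀)` whenever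
`R₀ ≤ qⁿ R`. [folklore] -/
theorem iterate_bound {f : ℕ → ℝ} (hf : ∀ R R', R ≤ R' → f R' ≤ f R)
    {A C q : ℝ} (hA : 0 ≤ A) (hC : 1 ≤ C) (hq : 0 ≤ q) {t : ℕ → ℕ} {Rmin R₀ : ℕ}
    (hstep : ∀ R, Rmin ≤ R → R < R₀ → f R ≤ max A (C * f (R + t R)))
    (hgrow : ∀ R, Rmin ≤ R → q * R ≤ (R : ℝ) + t R) :
    ∀ n : ℕ, ∀ R, Rmin ≤ R → (R₀ : ℝ) ≤ q ^ n * R → f R ≤ C ^ n * max A (f R₀) := by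
  intro n
  induction n with
  | zero =>
    intro R _ hR
    rw [pow_zero, one_mul] at hR
    rw [pow_zero, one_mul]
    exact (hf R₀ R (by exact_mod_cast hR)).trans (le_max_right _ _)
  | succ n ih =>
    intro R hRmin hR
    have hmax0 : 0 ≤ max A (f R₀) := le_max_of_le_left hA
    have hCn : 1 ≤ C ^ n := one_le_pow₀ hC
    by_cases hRR₀ : R₀ ≤ R
    · calc f R ≤ max A (f R₀) := (hf R₀ R hRR₀).trans (le_max_right _ _)
        _ ≤ C ^ (n + 1) * max A (f R₀) := le_mul_of_one_le_left hmax0 (one_le_pow₀ hC)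
    · push Not at hRR₀
      have h1 := hstep R hRmin hRR₀
      have h2 : (R₀ : ℝ) ≤ q ^ n * ((R + t R : ℕ) : ℝ) := by
        have hg := hgrow R hRmin
        have hqn : 0 ≤ q ^ n := pow_nonneg hq n
        calc (R₀ : ℝ) ≤ q ^ (n + 1) * R := hR
          _ = q ^ n * (q * R) := by rw [pow_succ]; ring
          _ ≤ q ^ n * ((R + t R : ℕ) : ℝ) := by
              push_cast; exact mul_le_mul_of_nonneg_left hg hqn
      have h3 := ih (R + t R) (le_trans hRmin (Nat.le_add_right _ _)) h2
      calc f R ≤ max A (C * f (R + t R)) := h1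
        _ ≤ max A (C * (C ^ n * max A (f R₀))) := max_le_max le_rfl (mul_le_mul_of_nonneg_left h3 (by linarith))
        _ = max A (C ^ (n + 1) * max A (f R₀)) := by rw [pow_succ]; ring_nf
        _ ≤ C ^ (n + 1) * max A (f R₀) := by
            refine max_le ?_ le_rfl
            calc A ≤ max A (f R₀) := le_max_left _ _
              _ ≤ C ^ (n + 1) * max A (f R₀) := le_mul_of_one_le_left hmax0 (one_le_pow₀ hC)

/-! ### The one-step inequality for all small `δ` -/

/-- Points within less than `infDist c Ωᶜ` of `c` are in `Ω`. [folklore] -/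
theorem closedBall_subset_of_lt_infDist {c : ℂ} {ρ : ℝ} (h : ρ < infDist c Ωᶜ) : closedBall c ρ ⊆ Ω := by
  intro z hz
  by_contra hzΩ
  have h1 : infDist c Ωᶜ ≤ dist c z := infDist_le_dist_of_mem hzΩ
  rw [mem_closedBall, _root_.dist_comm] at hz
  linarith

/-- A site of a box around a cell near `c` is near `c`. [folklore] -/
theorem dist_le_of_mem_sqBox_of_le {δ r : ℝ} (hδ : 0 < δ) {q y : Site 2} {c : ℂ} (hq : dist (meshPoint δ q) c ≤ 3 * δ)
    {n : ℕ} (hy : y ∈ sqBox q n) (hn : ((n : ℝ) + 2) * δ ≤ r) : dist (meshPoint δ y) c ≤ 2 * r := by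
  have h1 := dist_meshPoint_le_two_mul_of_mem_sqBox hδ.le hy
  push_cast at h1
  have := dist_triangle (meshPoint δ y) (meshPoint δ q) c
  nlinarith

set_option maxHeartbeats 400000 in
/-- **The one-step inequality `𝓜_δ(R) ≤ max(N_δ/2, 132 𝓜_δ(R + t(R)))` for all small `δ`** and all
radii `R_min ≤ R ≤ R₀(δ)`, provided `ε₀` is small (depending on `Ω, a, b`). [cite: ChelkakHonglerIzyurovAnnals2015, Lemma 3.10 and §3.4 (M_δ(ε₁) ≤ C M_δ(ε))] -/
theorem eventually_oneStep (hΩo : IsOpen Ω) (hΩc : IsConnected Ω) (hΩb : Bornology.IsBounded Ω) (hM : MeshApproximates Ω)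
    (ha : a ∈ Ω) (hb : b ∈ Ω) (hab : a ≠ b) (hHF : ∀ᶠ δ in 𝓝[>] (0 : ℝ), HoleFree (↑(meshInteriorFinset Ω δ) : Set (Site 2)))
    (hS : ∀ᶠ δ in 𝓝[>] (0 : ℝ), srcMag0 Ω a b δ ≠ 0) :
    ∃ εmax > 0, 8 * εmax ≤ infDist a Ωᶜ ∧ 8 * εmax ≤ infDist b Ωᶜ ∧ ∀ ε₀ : ℝ, 0 < ε₀ → ε₀ ≤ εmax →
      ∀ᶠ δ in 𝓝[>] (0 : ℝ), ∀ R : ℕ, minRadius ≤ R → R ≤ refRadius ε₀ δ →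
        supDev Ω a b δ R ≤ max (twoPointNorm Ω a b ε₀ δ / 2) (132 * supDev Ω a b δ (R + stepWidth R)) := by
  have hΩuniv : Ω ≠ univ := fun h => by
    have := hΩb; rw [h] at this; exact NormedSpace.unbounded_univ ℝ ℂ this
  have hΩc' : Ωᶜ.Nonempty := Set.nonempty_compl.2 hΩuniv
  have hκ := beurlingKappa_pos
  obtain ⟨rs, hrs, hsink⟩ := twoPointFamily_layer_sink hΩo hΩc hM ha hHF hb hab
  obtain ⟨ra, hra, hsource⟩ := twoPointFamily_layer_source hΩo hΩc hM ha hHF (b := b) hab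
  have hda : 0 < infDist a Ωᶜ := by
    rw [← infDist_pos_iff_notMem_closure hΩc', hΩo.isClosed_compl.closure_eq]; exact fun h => h ha
  have hdb : 0 < infDist b Ωᶜ := by
    rw [← infDist_pos_iff_notMem_closure hΩc', hΩo.isClosed_compl.closure_eq]; exact fun h => h hb
  have hab' : 0 < dist a b := dist_pos.2 hab
  -- the working radius `r` and `εmax`
  obtain ⟨r, hr0, hrs', hra', hr_a, hr_b, hr_ab⟩ : ∃ r : ℝ, 0 < r ∧ r ≤ rs ∧ r ≤ ra ∧ r ≤ infDist a Ωᶜ / 8 ∧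
      r ≤ infDist b Ωᶜ / 8 ∧ r ≤ dist a b / 16 := by
    refine ⟨min (min rs ra) (min (min (infDist a Ωᶜ / 8) (infDist b Ωᶜ / 8)) (dist a b / 16)), by positivity, ?_, ?_, ?_, ?_, ?_⟩
    · exact (min_le_left _ _).trans (min_le_left _ _)
    · exact (min_le_left _ _).trans (min_le_right _ _)
    · exact (min_le_right _ _).trans ((min_le_left _ _).trans (min_le_left _ _))
    · exact (min_le_right _ _).trans ((min_le_left _ _).trans (min_le_right _ _))
    · exact (min_le_right _ _).trans (min_le_right _ _)
  obtain ⟨εmax, hεmax⟩ : ∃ εmax : ℝ, εmax = r / (2 * (2 + beurlingKappa)) := ⟨_, rfl⟩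
  have hεmax0 : 0 < εmax := by rw [hεmax]; positivity
  have hεr : εmax * (2 * (2 + beurlingKappa)) = r := by rw [hεmax]; field_simp
  have hεr' : εmax ≤ r / 4 := by
    rw [le_div_iff₀ (by norm_num)]; nlinarith
  refine ⟨εmax, hεmax0, by linarith, by linarith, fun ε₀ hε₀ hε₀max => ?_⟩
  have hε₀a : 8 * ε₀ ≤ infDist a Ωᶜ := by linarith
  have hε₀b : 8 * ε₀ ≤ infDist b Ωᶜ := by linarith
  have hε₀r : (2 + beurlingKappa) * ε₀ ≤ r / 2 := by nlinarith
  -- balls in `Ω`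
  have hballa : closedBall a (3 * r) ⊆ Ω := closedBall_subset_of_lt_infDist (by linarith)
  have hballb : closedBall b (3 * r) ⊆ Ω := closedBall_subset_of_lt_infDist (by linarith)
  obtain ⟨d, hd, hcol⟩ := eventually_collar hΩo hΩb hM ha hHF hS hε₀ hε₀a hε₀b
  have hδsmall : ∀ᶠ δ in 𝓝[>] (0 : ℝ), δ ≤ min (d / 8) (r / (2 * (12 + beurlingKappa))) :=
    mem_nhdsWithin_of_mem_nhds (Iic_mem_nhds (by positivity))
  filter_upwards [eventually_goodScale hΩo hM ha hHF, eventually_deep_mem_compVol hΩo hΩc hΩb hM ha hd, hcol, hsink, hsource,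
    eventually_ball_subset_compVol hΩo hΩc hM ha hballa, eventually_ball_subset_compVol hΩo hΩc hM ha hballb, hδsmall,
    self_mem_nhdsWithin] with δ hgood hdeep hcol hsink hsource hbulka hbulkb hδsmall hδ0
  have hδ0 : (0 : ℝ) < δ := hδ0
  have hδd : 8 * δ ≤ d := by linarith [hδsmall.trans (min_le_left _ _)]
  have hδr : δ * (2 * (12 + beurlingKappa)) ≤ r := by
    have := hδsmall.trans (min_le_right _ _); rwa [le_div_iff₀ (by positivity)] at this
  intro R hRmin hRR₀
  obtain ⟨hR3, ht6, hgrow⟩ := stepWidth_bounds hRmin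
  obtain ⟨t, ht⟩ : ∃ t : ℕ, t = stepWidth R := ⟨_, rfl⟩
  rw [← ht] at ht6 hgrow ⊢
  obtain ⟨R₂, hR₂⟩ : ∃ R₂ : ℕ, R₂ = 2 * R + t + 8 := ⟨_, rfl⟩
  -- `(R₂ + 2) δ ≤ r`
  have hR₀ := (refRadius_mul_bounds hε₀.le hδ0).2
  have hRR₀' : (R : ℝ) ≤ refRadius ε₀ δ := by exact_mod_cast hRR₀
  have hRδ : (R : ℝ) * δ ≤ ε₀ + δ := by nlinarith
  have hbox : ((R₂ : ℝ) + 2) * δ ≤ r := by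
    have e : ((R₂ : ℝ) + 2) = 2 * R + t + 10 := by rw [hR₂]; push_cast; ring
    rw [e]
    have h0 : (3 : ℝ) ≤ R := by exact_mod_cast hR3
    have h1 : (t : ℝ) ≤ beurlingKappa * R := by nlinarith
    have h2 : (2 * (R : ℝ) + t + 10) * δ ≤ (2 + beurlingKappa) * ((R : ℝ) * δ) + 10 * δ := by nlinarith
    have h3 : (2 + beurlingKappa) * ((R : ℝ) * δ) ≤ (2 + beurlingKappa) * (ε₀ + δ) := by nlinarith
    nlinarith
  -- membership of the boxes and separation
  have hpa : dist (meshPoint δ (sourcePlaq δ a)) a ≤ 3 * δ :=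
    (dist_triangle _ (meshPoint δ (nearestSite δ a)) _).trans (by
      linarith [dist_meshPoint_sourcePlaq_le hδ0.le a, dist_meshPoint_nearestSite_le hδ0 a])
  have hpb : dist (meshPoint δ (nearestSite δ b)) b ≤ 3 * δ := by linarith [dist_meshPoint_nearestSite_le hδ0 b]
  have hboxb : ∀ y ∈ sqBox (nearestSite δ b) R₂, y ∈ compVol Ω a δ := fun y hy =>
    hbulkb y ((dist_le_of_mem_sqBox_of_le hδ0 hpb hy hbox).trans (by linarith))
  have hboxa : ∀ y ∈ sqBox (sourcePlaq δ a) R₂, y ∈ compVol Ω a δ := fun y hy =>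
    hbulka y ((dist_le_of_mem_sqBox_of_le hδ0 hpa hy hbox).trans (by linarith))
  have hsep : ∀ y ∈ sqBox (nearestSite δ b) R₂, y ∉ sqBox (sourcePlaq δ a) R₂ := fun y hy hy' => by
    have h1 := dist_le_of_mem_sqBox_of_le hδ0 hpb hy hbox
    have h2 := dist_le_of_mem_sqBox_of_le hδ0 hpa hy' hbox
    have := dist_triangle a (meshPoint δ y) b
    rw [_root_.dist_comm a (meshPoint δ y)] at this
    linarith
  -- the Beurling ratios
  have hR2 : 2 ≤ R := by omega
  have hR1 : (((R - 2 : ℕ) : ℝ) + 1) = (R : ℝ) - 1 := by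
    have : ((R - 2 : ℕ) : ℝ) = (R : ℝ) - 2 := by rw [Nat.cast_sub hR2]; norm_num
    rw [this]; ring
  have hR3' : (3 : ℝ) ≤ R := by exact_mod_cast hR3
  have hRpos : 0 < (R : ℝ) - 1 := by linarith
  have ht5 : (((t + 5 : ℕ) : ℝ) + 1) = (t : ℝ) + 6 := by push_cast; ring
  have ht3 : (((t + 3 : ℕ) : ℝ) + 1) = (t : ℝ) + 4 := by push_cast; ring
  have hBsrc : beurlingConst * ((((t + 5 : ℕ) : ℝ) + 1) / (((R - 2 : ℕ) : ℝ) + 1)) ^ beurlingExp ≤ 1 / 2 := by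
    rw [hR1, ht5]
    exact beurling_small_of_le (div_nonneg (by positivity) hRpos.le) (by rw [div_le_iff₀ hRpos]; linarith)
  have hBsnk : beurlingConst * ((((t + 3 : ℕ) : ℝ) + 1) / (((R - 2 : ℕ) : ℝ) + 1)) ^ beurlingExp ≤ 1 / 2 := by
    rw [hR1, ht3]
    exact beurling_small_of_le (div_nonneg (by positivity) hRpos.le) (by rw [div_le_iff₀ hRpos]; linarith)
  -- assemble
  have h1 : R + t ≤ R₂ := by omega
  have h2 : 2 * R ≤ R₂ := by omega
  have h3 : R + t + 6 ≤ R₂ := by omega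
  have h4 : 2 * R + 2 ≤ R₂ := by omega
  have h5 : R + t + 8 ≤ R₂ := by omega
  have hs1 : ∀ c₀ m : ℝ, 0 ≤ m →
      (∀ y ∈ sqBox (nearestSite δ b) R₂, y ∉ sqBox (nearestSite δ b) ((R : ℤ) + t) →
        |(twoPointFamily Ω a b).Hw δ y - c₀| ≤ m ∧ |(twoPointFamily Ω a b).Hb δ y - c₀| ≤ m) →
      ∀ u₀ ∈ sqBox (nearestSite δ b) R, u₀ ∉ sqBox (nearestSite δ b) ((R : ℤ) - 1) →
        -(132 * m) ≤ (twoPointFamily Ω a b).Hw δ u₀ - c₀ ∧ (twoPointFamily Ω a b).Hw δ u₀ - c₀ ≤ m ∧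
        -(132 * m) ≤ (twoPointFamily Ω a b).Hb δ u₀ - c₀ ∧ (twoPointFamily Ω a b).Hb δ u₀ - c₀ ≤ m :=
    hsink R t R₂ hR3 h2 h3 (hbox.trans hrs') hBsnk
  have hs2 : ∀ c₀ m : ℝ, 0 ≤ m →
      (∀ y ∈ sqBox (sourcePlaq δ a) R₂, y ∉ sqBox (sourcePlaq δ a) ((R : ℤ) + t) →
        |(twoPointFamily Ω a b).Hw δ y - c₀| ≤ m ∧ |(twoPointFamily Ω a b).Hb δ y - c₀| ≤ m) →
      ∀ f₀ ∈ sqBox (sourcePlaq δ a) R, f₀ ∉ sqBox (sourcePlaq δ a) ((R : ℤ) - 1) →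
        -m ≤ (twoPointFamily Ω a b).Hw δ f₀ - c₀ ∧ (twoPointFamily Ω a b).Hw δ f₀ - c₀ ≤ 132 * m ∧
        -m ≤ (twoPointFamily Ω a b).Hb δ f₀ - c₀ ∧ (twoPointFamily Ω a b).Hb δ f₀ - c₀ ≤ 132 * m :=
    hsource R t R₂ hR3 h4 h5 (hbox.trans hra') hBsrc
  exact oneStep_core hδ0 hgood h1 (twoPointNorm_nonneg ε₀ δ) hδd hdeep hcol.1 hcol.2 hboxb hboxa hsep hs1 hs2

/-! ### The a-priori bound -/

/-- **CHI's "`M_δ(ε₁) ≤ C M_δ(ε)`" for the two-point family**: for `ε₀` small and every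
`θ ∈ (0, 1]` there is `C` with `𝓜_δ(R₀(θ ε₀)) ≤ C N_δ` for all small `δ`. [cite: ChelkakHonglerIzyurovAnnals2015, §3.4 (uniform boundedness of H_δ away from a, a₁)] -/
theorem eventually_supDev_le (hΩo : IsOpen Ω) (hΩc : IsConnected Ω) (hΩb : Bornology.IsBounded Ω) (hM : MeshApproximates Ω)
    (ha : a ∈ Ω) (hb : b ∈ Ω) (hab : a ≠ b) (hHF : ∀ᶠ δ in 𝓝[>] (0 : ℝ), HoleFree (↑(meshInteriorFinset Ω δ) : Set (Site 2)))
    (hS : ∀ᶠ δ in 𝓝[>] (0 : ℝ), srcMag0 Ω a b δ ≠ 0) :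
    ∃ εmax > 0, 8 * εmax ≤ infDist a Ωᶜ ∧ 8 * εmax ≤ infDist b Ωᶜ ∧ ∀ ε₀ : ℝ, 0 < ε₀ → ε₀ ≤ εmax →
      ∀ θ : ℝ, 0 < θ → θ ≤ 1 → ∃ C > 0, ∀ᶠ δ in 𝓝[>] (0 : ℝ),
        supDev Ω a b δ (refRadius (θ * ε₀) δ) ≤ C * twoPointNorm Ω a b ε₀ δ := by
  obtain ⟨εmax, hεmax, hεa, hεb, hstep⟩ := eventually_oneStep hΩo hΩc hΩb hM ha hb hab hHF hS
  refine ⟨εmax, hεmax, hεa, hεb, fun ε₀ hε₀ hε₀max θ hθ hθ1 => ?_⟩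
  have hκ := beurlingKappa_pos
  obtain ⟨q, hq⟩ : ∃ q : ℝ, q = 1 + beurlingKappa / 2 := ⟨_, rfl⟩
  have hq1 : 1 < q := by rw [hq]; linarith
  obtain ⟨n, hn⟩ := pow_unbounded_of_one_lt (2 / θ) hq1
  refine ⟨132 ^ n, by positivity, ?_⟩
  have hδsmall : ∀ᶠ δ in 𝓝[>] (0 : ℝ), δ ≤ min ε₀ (θ * ε₀ / ((minRadius : ℝ) + 1)) :=
    mem_nhdsWithin_of_mem_nhds (Iic_mem_nhds (by positivity))
  filter_upwards [hstep ε₀ hε₀ hε₀max, hδsmall, self_mem_nhdsWithin] with δ hstep hδsmall hδ0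
  have hδ0 : (0 : ℝ) < δ := hδ0
  have hδε : δ ≤ ε₀ := hδsmall.trans (min_le_left _ _)
  have hδθ : δ * ((minRadius : ℝ) + 1) ≤ θ * ε₀ := by
    have := hδsmall.trans (min_le_right _ _); rwa [le_div_iff₀ (by positivity)] at this
  have hR₀b := refRadius_mul_bounds hε₀.le hδ0
  have hRθb := refRadius_mul_bounds (by positivity : 0 ≤ θ * ε₀) hδ0
  -- `Rθ ≥ R_min`
  have hRθmin : minRadius ≤ refRadius (θ * ε₀) δ := by
    have h1 : ((minRadius : ℝ) + 1) * δ ≤ (refRadius (θ * ε₀) δ : ℝ) * δ := by nlinarith [hRθb.1]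
    have h2 : (minRadius : ℝ) + 1 ≤ refRadius (θ * ε₀) δ := le_of_mul_le_mul_right h1 hδ0
    exact_mod_cast (by linarith : (minRadius : ℝ) ≤ refRadius (θ * ε₀) δ)
  -- `R₀ ≤ qⁿ Rθ`
  have hreach : (refRadius ε₀ δ : ℝ) ≤ q ^ n * (refRadius (θ * ε₀) δ : ℝ) := by
    have h1 : (refRadius ε₀ δ : ℝ) * δ ≤ 2 * ε₀ := by linarith [hR₀b.2]
    have h5 : 0 ≤ q ^ n := pow_nonneg (by linarith) n
    have h3 : θ * ε₀ ≤ (refRadius (θ * ε₀) δ : ℝ) * δ := hRθb.1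
    have h4 : 2 * ε₀ = 2 / θ * (θ * ε₀) := by field_simp
    have h2 : 2 * ε₀ ≤ q ^ n * ((refRadius (θ * ε₀) δ : ℝ) * δ) := by
      have h7 := mul_le_mul_of_nonneg_left h3 h5
      have h8 := mul_le_mul_of_nonneg_right hn.le (by positivity : 0 ≤ θ * ε₀)
      linarith
    have h6 : (refRadius ε₀ δ : ℝ) * δ ≤ (q ^ n * refRadius (θ * ε₀) δ) * δ := by nlinarith
    exact le_of_mul_le_mul_right h6 hδ0
  have key := iterate_bound (f := supDev Ω a b δ) (fun R R' h => supDev_antitone h)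
    (A := twoPointNorm Ω a b ε₀ δ / 2) (C := 132) (q := q) (by linarith [twoPointNorm_nonneg (Ω := Ω) (a := a) (b := b) ε₀ δ])
    (by norm_num) (by linarith) (t := stepWidth) (Rmin := minRadius) (R₀ := refRadius ε₀ δ)
    (fun R hR hRR₀ => hstep R hR hRR₀.le) (fun R hR => by
      have := (stepWidth_bounds hR).2.2; rw [hq]; nlinarith) n (refRadius (θ * ε₀) δ) hRθmin hreach
  have hN := twoPointNorm_nonneg (Ω := Ω) (a := a) (b := b) ε₀ δ
  have hmax : max (twoPointNorm Ω a b ε₀ δ / 2) (supDev Ω a b δ (refRadius ε₀ δ)) ≤ twoPointNorm Ω a b ε₀ δ :=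
    max_le (by linarith) (supDev_le_twoPointNorm ε₀ δ)
  calc supDev Ω a b δ (refRadius (θ * ε₀) δ)
      ≤ 132 ^ n * max (twoPointNorm Ω a b ε₀ δ / 2) (supDev Ω a b δ (refRadius ε₀ δ)) := key
    _ ≤ 132 ^ n * twoPointNorm Ω a b ε₀ δ := mul_le_mul_of_nonneg_left hmax (by positivity)

/-- **The a-priori bound on compacts** (CHI15 §3.4: "`H_δ` remain uniformly bounded on `Ω_δ(ε)`",
in renormalised form): for `ε₀` small and every compact `K ⊆ Ω ∖ {a, b}` there is `C` with
`|Hw - c_δ| ≤ C N_δ` at the free sites and `|Hb - c_δ| ≤ C N_δ` at the touching plaquettes with mesh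
point in `K`, for all small `δ`. [cite: ChelkakHonglerIzyurovAnnals2015, §3.4 (uniform boundedness of H_δ away from a, a₁)] -/
theorem apriori_bound (hΩo : IsOpen Ω) (hΩc : IsConnected Ω) (hΩb : Bornology.IsBounded Ω) (hM : MeshApproximates Ω)
    (ha : a ∈ Ω) (hb : b ∈ Ω) (hab : a ≠ b) (hHF : ∀ᶠ δ in 𝓝[>] (0 : ℝ), HoleFree (↑(meshInteriorFinset Ω δ) : Set (Site 2)))
    (hS : ∀ᶠ δ in 𝓝[>] (0 : ℝ), srcMag0 Ω a b δ ≠ 0) :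
    ∃ εmax > 0, 8 * εmax ≤ infDist a Ωᶜ ∧ 8 * εmax ≤ infDist b Ωᶜ ∧ ∀ ε₀ : ℝ, 0 < ε₀ → ε₀ ≤ εmax →
      ∀ K ⊆ Ω \ {a, b}, IsCompact K → ∃ C > 0, ∀ᶠ δ in 𝓝[>] (0 : ℝ), ∀ y : Site 2, meshPoint δ y ∈ K →
        (y ∈ compVol Ω a δ → |(twoPointFamily Ω a b).Hw δ y - frozenVal Ω a b δ| ≤ C * twoPointNorm Ω a b ε₀ δ) ∧
        (y ∈ touchPlaquettes (compVol Ω a δ) → |(twoPointFamily Ω a b).Hb δ y - frozenVal Ω a b δ| ≤ C * twoPointNorm Ω a b ε₀ δ) := by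
  obtain ⟨εmax, hεmax, hεa, hεb, hsup⟩ := eventually_supDev_le hΩo hΩc hΩb hM ha hb hab hHF hS
  refine ⟨εmax, hεmax, hεa, hεb, fun ε₀ hε₀ hε₀max K hKU hK => ?_⟩
  have hdisj : Disjoint K ({a, b} : Set ℂ) := Set.disjoint_left.2 fun z hz hz' => (hKU hz).2 hz'
  obtain ⟨ρ, hρ, hρK⟩ := exists_pos_forall_lt_infDist hK (Set.toFinite {a, b}).isClosed hdisj ⟨a, mem_insert _ _⟩
  set θ : ℝ := min 1 (ρ / (4 * ε₀)) with hθ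
  have hθ0 : 0 < θ := by positivity
  have hθ1 : θ ≤ 1 := min_le_left _ _
  have hθρ : θ * ε₀ ≤ ρ / 4 := by
    have : θ ≤ ρ / (4 * ε₀) := min_le_right _ _
    rw [le_div_iff₀ (by positivity)] at this; linarith
  obtain ⟨C, hC, hev⟩ := hsup ε₀ hε₀ hε₀max θ hθ0 hθ1
  refine ⟨C, hC, ?_⟩
  have hδsmall : ∀ᶠ δ in 𝓝[>] (0 : ℝ), δ < ρ / 10 := mem_nhdsWithin_of_mem_nhds (Iio_mem_nhds (by positivity))
  filter_upwards [hev, hδsmall, self_mem_nhdsWithin] with δ hev hδρ hδ0 y hyK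
  have hδ0 : (0 : ℝ) < δ := hδ0
  have hRb := (refRadius_mul_bounds (by positivity : 0 ≤ θ * ε₀) hδ0).2
  -- `y` is outside both boxes of radius `R₀(θ ε₀)`
  have hfar : ∀ (q : Site 2) (c : ℂ), c ∈ ({a, b} : Set ℂ) → dist (meshPoint δ q) c ≤ 3 * δ → y ∉ sqBox q (refRadius (θ * ε₀) δ) := by
    intro q c hc hq hyq
    have h1 := dist_meshPoint_le_two_mul_of_mem_sqBox hδ0.le hyq
    push_cast at h1
    have h2 : ρ < infDist (meshPoint δ y) {a, b} := hρK _ hyK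
    have h3 : infDist (meshPoint δ y) {a, b} ≤ dist (meshPoint δ y) c := infDist_le_dist_of_mem hc
    have h4 := dist_triangle (meshPoint δ y) (meshPoint δ q) c
    nlinarith
  have hpa : dist (meshPoint δ (sourcePlaq δ a)) a ≤ 3 * δ :=
    (dist_triangle _ (meshPoint δ (nearestSite δ a)) _).trans (by
      linarith [dist_meshPoint_sourcePlaq_le hδ0.le a, dist_meshPoint_nearestSite_le hδ0 a])
  have hpb : dist (meshPoint δ (nearestSite δ b)) b ≤ 3 * δ := by linarith [dist_meshPoint_nearestSite_le hδ0 b]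
  have hya := hfar _ a (by simp) hpa
  have hyb := hfar _ b (by simp) hpb
  exact ⟨fun hyΛ => (abs_hw_le_supDev (mem_regionW.2 ⟨hyΛ, hya, hyb⟩)).trans hev,
    fun hyt => (abs_hb_le_supDev (mem_regionB.2 ⟨hyt, hya, hyb⟩)).trans hev⟩

/-! ### Non-degeneracy: the cell `z^max` -/

/-- **The cell `z^max_δ` of CHI's Lemma 3.10**: for all small `δ`, either `𝓜_δ(R₀) ≤ N_δ/2`, or
`|H - c_δ| ≥ 𝓜_δ(R₀)` at a free site or a touching plaquette of the layer of radius `R₀(δ)` around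
`a` or `b`. [cite: ChelkakHonglerIzyurovAnnals2015, proof of Lemma 3.10 (z^max on the circles)] -/
theorem eventually_nondegenerate (hΩo : IsOpen Ω) (hΩc : IsConnected Ω) (hΩb : Bornology.IsBounded Ω) (hM : MeshApproximates Ω)
    (ha : a ∈ Ω) (hHF : ∀ᶠ δ in 𝓝[>] (0 : ℝ), HoleFree (↑(meshInteriorFinset Ω δ) : Set (Site 2)))
    (hS : ∀ᶠ δ in 𝓝[>] (0 : ℝ), srcMag0 Ω a b δ ≠ 0)
    {ε₀ : ℝ} (hε₀ : 0 < ε₀) (hε₀a : 8 * ε₀ ≤ infDist a Ωᶜ) (hε₀b : 8 * ε₀ ≤ infDist b Ωᶜ) :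
    ∀ᶠ δ in 𝓝[>] (0 : ℝ),
      supDev Ω a b δ (refRadius ε₀ δ) ≤ twoPointNorm Ω a b ε₀ δ / 2 ∨
      (∃ v ∈ compVol Ω a δ, InLayer a b δ v (refRadius ε₀ δ) ∧
        supDev Ω a b δ (refRadius ε₀ δ) ≤ |(twoPointFamily Ω a b).Hw δ v - frozenVal Ω a b δ|) ∨
      (∃ f ∈ touchPlaquettes (compVol Ω a δ), InLayer a b δ f (refRadius ε₀ δ) ∧
        supDev Ω a b δ (refRadius ε₀ δ) ≤ |(twoPointFamily Ω a b).Hb δ f - frozenVal Ω a b δ|) := by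
  obtain ⟨d, hd, hcol⟩ := eventually_collar hΩo hΩb hM ha hHF hS hε₀ hε₀a hε₀b
  have hδsmall : ∀ᶠ δ in 𝓝[>] (0 : ℝ), δ ≤ d / 8 := mem_nhdsWithin_of_mem_nhds (Iic_mem_nhds (by positivity))
  filter_upwards [eventually_goodScale hΩo hM ha hHF, eventually_deep_mem_compVol hΩo hΩc hΩb hM ha hd, hcol, hδsmall,
    self_mem_nhdsWithin] with δ hgood hdeep hcol hδsmall hδ0
  have hδ0 : (0 : ℝ) < δ := hδ0
  have hN := twoPointNorm_nonneg (Ω := Ω) (a := a) (b := b) ε₀ δ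
  have key := supDev_le_max_layerDev (Ω := Ω) (a := a) (b := b) hδ0 hgood (refRadius ε₀ δ) (by positivity) (by linarith)
    hdeep hcol.1 hcol.2
  by_cases hL : supDev Ω a b δ (refRadius ε₀ δ) ≤ layerDev Ω a b δ (refRadius ε₀ δ)
  · by_cases hL0 : layerDev Ω a b δ (refRadius ε₀ δ) ≤ 0
    · exact Or.inl (by linarith)
    · push Not at hL0
      rcases exists_cell_layerDev hL0 with ⟨v, hv, hvl, hveq⟩ | ⟨f, hf, hfl, hfeq⟩
      · exact Or.inr (Or.inl ⟨v, hv, hvl, by rw [hveq]; exact hL⟩)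
      · exact Or.inr (Or.inr ⟨f, hf, hfl, by rw [hfeq]; exact hL⟩)
  · push Not at hL
    left
    rcases le_max_iff.1 key with h | h
    · exact h
    · linarith

end Literature.Probability.LatticeModels
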